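import Summits.QuantumAdvantage.QuantumAdvantage.Theorems.CharDialTokenDialK
import HarnessLib

/-!
# CharDial tower — the TOKEN DIAL, part M1: the flip dial at LOGARITHMIC budget (`K = w = dialB n = 4(log₂ n + 1)`)

Cell `decomp-qadv`, lens 6 («barrier-complement carving»), generation 19 (REV3); supports stmt-QuantumAdvantage-27206 / 27207
(crux 32604).  Imports part K (`flip_bound`).

The engine's error term is `8·p^{K+1}·2^{Σ|J_g| + 2w}·(2cos(π/3p))ⁿ`: QUASI-POLYNOMIAL budgets `K, w = O(log n)` are still beaten by
`cos(π/3p)ⁿ`.  (1) `quasiPoly_exp_small`: for `0 ≤ a < 1` and naturals `A, B`, `n^{A(log₂ n + 1) + B}·aⁿ ≤ 1` eventually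
(from Mathlib's `(log x)² = o(x)`).  (2) `eventually_smallLog`: `64·4^{dialB n}·p^{dialB n + 2}·n^{dialB n + 1}·cos(π/3p)ⁿ ≤ 1`
eventually.  (3) ★ `flip_hard_log`: for every prime `p ≠ 3`, eventually in `n`, a `log₂ n`-junta presentation whose strategy meets
`FlipHyp p (dialB n) (dialB n)` — at most `4(log₂ n + 1)` movers, all within distance `4(log₂ n + 1)` of the pair, `flipAny ≥ 2ⁿ/(4p)` —
wins on at most `(1 − 1/(48p))·2ⁿ` inputs.  This budget covers every sliding-window junta family of the toy census (width ≤ log₂ n,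
`w + 1` movers per interior pair).  0 sorry.  Part M files the log-budget pieces and joins them to `T` by name.
-/

set_option autoImplicit false

open Finset

namespace Summit.QuantumAdvantage.AdviceFreeQNC0.JLinPeel.TokenDial

open SegMove

variable {n : ℕ}

section LogBudget

/-- **(quasi-polynomial against exponential).** for `0 ≤ a < 1` and naturals `A, B`: `n^{A·(log₂ n + 1) + B}·aⁿ ≤ 1` for all large `n`. -/
theorem quasiPoly_exp_small (a : ℝ) (ha0 : 0 ≤ a) (ha1 : a < 1) (A B : ℕ) :
    ∃ n₀ : ℕ, ∀ n ≥ n₀, (n : ℝ) ^ (A * (Nat.log 2 n + 1) + B) * a ^ n ≤ 1 := by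
  rcases ha0.eq_or_lt with ha | ha
  · refine ⟨1, fun n hn => ?_⟩
    rw [← ha, zero_pow (by omega), mul_zero]
    exact zero_le_one
  set b : ℝ := -Real.log a with hb
  have hb0 : 0 < b := by rw [hb]; linarith [Real.log_neg ha ha1]
  have hlog2 : 0 < Real.log 2 := Real.log_pos (by norm_num)
  set C : ℝ := ((A + B + 1 : ℕ) : ℝ) * (1 / Real.log 2 + 1) with hC
  have hC0 : 0 < C := by rw [hC]; positivity
  have hCne : C ≠ 0 := hC0.ne'
  have hε : 0 < b / C := div_pos hb0 hC0
  have hev := Asymptotics.isLittleO_iff.mp (Real.isLittleO_pow_log_id_atTop (n := 2)) hε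
  rw [Filter.eventually_atTop] at hev
  obtain ⟨x₀, hx₀⟩ := hev
  refine ⟨max 3 (Nat.ceil x₀), fun n hn => ?_⟩
  have hn3 : 3 ≤ n := le_trans (le_max_left _ _) hn
  have hnx : x₀ ≤ n := le_trans (Nat.le_ceil x₀) (by exact_mod_cast le_trans (le_max_right _ _) hn)
  have hn0 : (0 : ℝ) < n := by exact_mod_cast (show 0 < n by omega)
  have hlogn1 : 1 ≤ Real.log n := by
    rw [← Real.log_exp 1]
    apply Real.log_le_log (Real.exp_pos 1)
    have := Real.exp_one_lt_d9
    have h3 : (3 : ℝ) ≤ n := by exact_mod_cast hn3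
    linarith
  -- (log n)² ≤ (b / C)·n
  have hsq : Real.log n ^ 2 ≤ b / C * n := by
    have h := hx₀ n hnx
    rw [id, Real.norm_of_nonneg (sq_nonneg _), Real.norm_of_nonneg hn0.le] at h
    exact h
  -- log₂ n + 1 ≤ (1/log 2 + 1)·log n
  have hL : ((Nat.log 2 n : ℕ) : ℝ) + 1 ≤ (1 / Real.log 2 + 1) * Real.log n := by
    have h2L : ((2 : ℕ) : ℝ) ^ Nat.log 2 n ≤ n := by exact_mod_cast Nat.pow_log_le_self 2 (by omega : n ≠ 0)
    have hlogL : (Nat.log 2 n : ℝ) * Real.log 2 ≤ Real.log n := by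
      rw [← Real.log_pow]
      exact Real.log_le_log (by positivity) (by exact_mod_cast h2L)
    have : (Nat.log 2 n : ℝ) ≤ Real.log n / Real.log 2 := by rw [le_div_iff₀ hlog2]; exact hlogL
    calc ((Nat.log 2 n : ℕ) : ℝ) + 1 ≤ Real.log n / Real.log 2 + Real.log n := by linarith
      _ = (1 / Real.log 2 + 1) * Real.log n := by ring
  -- the exponent: E·log n ≤ C·(log n)² ≤ b·n
  have hE : ((A * (Nat.log 2 n + 1) + B : ℕ) : ℝ) * Real.log n ≤ b * n := by
    have hL0 : (0 : ℝ) ≤ (Nat.log 2 n : ℝ) := Nat.cast_nonneg _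
    have hA0 : (0 : ℝ) ≤ (A : ℝ) := Nat.cast_nonneg _
    have hB0 : (0 : ℝ) ≤ (B : ℝ) := Nat.cast_nonneg _
    have h1 : ((A * (Nat.log 2 n + 1) + B : ℕ) : ℝ) ≤ ((A + B + 1 : ℕ) : ℝ) * (((Nat.log 2 n : ℕ) : ℝ) + 1) := by
      push_cast
      nlinarith
    have h2 : ((A * (Nat.log 2 n + 1) + B : ℕ) : ℝ) ≤ C * Real.log n :=
      calc ((A * (Nat.log 2 n + 1) + B : ℕ) : ℝ) ≤ ((A + B + 1 : ℕ) : ℝ) * (((Nat.log 2 n : ℕ) : ℝ) + 1) := h1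
        _ ≤ ((A + B + 1 : ℕ) : ℝ) * ((1 / Real.log 2 + 1) * Real.log n) :=
            mul_le_mul_of_nonneg_left hL (Nat.cast_nonneg _)
        _ = C * Real.log n := by rw [hC]; ring
    have hlogn0 : 0 ≤ Real.log n := by linarith
    calc ((A * (Nat.log 2 n + 1) + B : ℕ) : ℝ) * Real.log n ≤ C * Real.log n * Real.log n :=
          mul_le_mul_of_nonneg_right h2 hlogn0
      _ = C * Real.log n ^ 2 := by ring
      _ ≤ C * (b / C * n) := mul_le_mul_of_nonneg_left hsq hC0.le
      _ = b * n := by field_simp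
  -- conclude through `exp`
  have h1 : (n : ℝ) ^ (A * (Nat.log 2 n + 1) + B) = Real.exp (((A * (Nat.log 2 n + 1) + B : ℕ) : ℝ) * Real.log n) := by
    rw [Real.exp_nat_mul, Real.exp_log hn0]
  have h2 : a ^ n = Real.exp ((n : ℝ) * Real.log a) := by rw [Real.exp_nat_mul, Real.exp_log ha]
  rw [h1, h2, ← Real.exp_add, show (1 : ℝ) = Real.exp 0 from Real.exp_zero.symm, Real.exp_le_exp]
  have : (n : ℝ) * Real.log a = -(b * n) := by rw [hb]; ring
  rw [this]
  linarith

variable {p : ℕ} [hp : Fact p.Prime]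

omit hp in
/-- **the log-budget error schedule**: `64·4^{dialB n}·p^{dialB n + 2}·n^{dialB n + 1}·cos(π/3p)ⁿ ≤ 1` eventually. -/
theorem eventually_smallLog (p : ℕ) (hp2 : 2 ≤ p) : ∃ n₀ : ℕ, ∀ n ≥ n₀,
    64 * (4 : ℝ) ^ TowerDefs.dialB n * (p : ℝ) ^ (TowerDefs.dialB n + 2) * (n : ℝ) ^ (TowerDefs.dialB n + 1)
      * Real.cos (Real.pi / (3 * p)) ^ n ≤ 1 := by
  have hp1 : 1 ≤ p := by omega
  obtain ⟨hc0, hc1⟩ := cos_facts hp1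
  obtain ⟨n₀, hn₀⟩ := quasiPoly_exp_small _ hc0 hc1 12 4
  refine ⟨max n₀ (max 64 p), fun n hn => ?_⟩
  have hn0' : n₀ ≤ n := le_trans (le_max_left _ _) hn
  have h64 : (64 : ℝ) ≤ n := by exact_mod_cast le_trans (le_trans (le_max_left _ _) (le_max_right _ _)) hn
  have hpn : (p : ℝ) ≤ n := by exact_mod_cast le_trans (le_trans (le_max_right _ _) (le_max_right _ _)) hn
  have h4 : (4 : ℝ) ≤ n := by linarith
  have hcn : 0 ≤ Real.cos (Real.pi / (3 * p)) ^ n := pow_nonneg hc0 n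
  have he : 12 * (Nat.log 2 n + 1) + 4 = 3 * TowerDefs.dialB n + 4 := by unfold TowerDefs.dialB; ring
  have h := hn₀ n hn0'
  rw [he] at h
  calc 64 * (4 : ℝ) ^ TowerDefs.dialB n * (p : ℝ) ^ (TowerDefs.dialB n + 2) * (n : ℝ) ^ (TowerDefs.dialB n + 1)
        * Real.cos (Real.pi / (3 * p)) ^ n
      ≤ (n : ℝ) * (n : ℝ) ^ TowerDefs.dialB n * (n : ℝ) ^ (TowerDefs.dialB n + 2) * (n : ℝ) ^ (TowerDefs.dialB n + 1)
        * Real.cos (Real.pi / (3 * p)) ^ n := by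
        gcongr
    _ = (n : ℝ) ^ (3 * TowerDefs.dialB n + 4) * Real.cos (Real.pi / (3 * p)) ^ n := by ring
    _ ≤ 1 := h

/-- ★ **THE FLIP DIAL AT LOGARITHMIC BUDGET.** for every prime `p ≠ 3`, eventually in `n`: a `log₂ n`-junta ⊕ form presentation whose
strategy meets `FlipHyp p (dialB n) (dialB n)` — some adjacent pair with at most `4(log₂ n + 1)` non-swap-stable cuts, all numbered
within `4(log₂ n + 1)` of the pair, and `#flipAny ≥ 2ⁿ/(4p)` — wins on at most `(1 − 1/(48p))·2ⁿ` inputs, for every residue `c`. -/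
theorem flip_hard_log (hp3 : p ≠ 3) : ∃ n₀ : ℕ, ∀ n ≥ n₀, ∀ (c : ℕ) (D : JLinPeel.JLinData p n),
    (∀ g, (D.J g).card ≤ Nat.log 2 n) → TowerDefs.FlipHyp p (TowerDefs.dialB n) (TowerDefs.dialB n) D.strat →
      ((univ.filter fun u : Fin n → Bool => ringWinU c D.strat u = true).card : ℝ)
        ≤ (1 - 1 / (48 * p)) * (2 : ℝ) ^ n := by
  obtain ⟨n₀, hn₀⟩ := eventually_smallLog p hp.out.two_le
  refine ⟨max n₀ 1, fun n hn c D hJ hT => ?_⟩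
  exact flip_bound hp3 (TowerDefs.dialB n) (TowerDefs.dialB n) (le_trans (le_max_right _ _) hn)
    (hn₀ n (le_trans (le_max_left _ _) hn)) c D hJ hT

end LogBudget

end Summit.QuantumAdvantage.AdviceFreeQNC0.JLinPeel.TokenDial
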